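import Summits.ABC.IUTFork.Cor312NegLogThetaUpperPrVol
import Summits.ABC.IUTFork.Cor312HullVolumePrVolScaled
import Summits.ABC.IUTFork.Cor312PilotIdelesPrThetaSide
import HarnessLib

/-!
# [IUTchIII] Cor. 3.12 — the REGIME DICHOTOMY at the print-normalised sharp setting of record over ODD UNRAMIFIED bad
# primes: the Θ-side number EXACTLY, the `q`-side number EXACTLY, and the typed Statement DECIDED (up to the
# ramified/2 constant) by the slot-symmetrised Θ-exponents versus the `q`-exponents — in BOTH directions

PROOF-ONLY support piece of the abc-iut cell (Cor. 3.12 cone, D-0067; seat abc-iut-w4-d107, gen 4; part 7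
«GLOBAL-REGIME-VERBATIM» of the `Cor312NegLogThetaUpperPrVol*` chain). TAKES NO SIDE on [IUTchIII] Cor. 3.12; theorems
only, 0 `def`s, no new `Prop` fact. Combines abc-iut-c312-5's EXACT local hull value at an odd prime `p ∤ disc(F)`
(`thetaLocal_settingPrVolSharp_eq_of_zpow`, p433308: `−|log(Θ)|_{i+1,p} = Σ_{v⃗} Pr(v⃗)·(−min_a m_{i,p}(v⃗(a))·log p)`
for Θ-ideles of norms `‖t_{Θ,i+1,v}‖ = ‖p^{m_{i,p}(v)}‖` — the (Ind1)-symmetrisation «λ at the last slot ↦ λ_min»,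
plan/c312/STEPV-IND1-NOTE §2, Dupuy–Hilado §4.7) with this seat's global assembly (p432205) at abc-iut-c312-7's
`Real.settingPrVolSharp` (Θ-boxes and `q`-centre READ OFF the pilot ideles; no re-gluing). For pilot ideles whose bad
places all lie over a finite set `U` of ODD primes UNRAMIFIED in `F`:

* `negLogTheta_settingPrVolSharp_ge_exact` — `−|log(Θ)| ≥ Θside := PN_i Σ_{p∈U} Σ_{v⃗} Pr(v⃗)·(−min_a m_{i,p}(v⃗ a)·log p)`
  (exact at `U`, `≥ 0` at every other packet by box ≤ hull);
* `negLogQ_settingPrVolSharp_eq_exact` — `−|log(q)| = Qside := PN_i Σ_{p∈U} Σ_{v⃗} Pr(v⃗)·(−m_{q,p}(v⃗(last))·log p)`;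
* **`statement_settingPrVolSharp_of_qside_le_thetaside`** — `Qside ≤ Θside ⟹ Statement`: a POSITIVE instance of the
  typed [IUTchIII] Cor. 3.12 AT GENUINE DATA whenever the slot-symmetrised Θ-exponent mass does not exceed the
  `q`-exponent mass — e.g. sharp-realising ideles (`m_{i,p} = (i+1)²·m_{q,p}`) supported at ONE bad place `v_p` of bad
  mass `β_p` per prime with `PN_i((i+1)²·β_p^{i+1}) ≤ 1` for every `p` (a SPLIT regime: `β*(ℓ⋇ = 2) ≈ 0.53`); the
  inequality holds there BY (Ind1)-INFLATION at the mixed packets, not by the disputed (xi-e)/(xi-f) inference;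
* the NEGATIVE regime is part 4 (`settingPrVolSharp_not_statement_of_sharp_deep`,
  `exists_sharp_deep_ideles_not_statement`: bad mass one and deep `q` ⟹ `¬ Statement`); the refined negative form with
  the exact value at `U` and the constant `C₂(X, logv) ≥ 0` of the primes `2` and `p | disc(F)` only
  (`Θside + C₂ < Qside ⟹ ¬ Statement`) is the one-line combination of §1–§2 here with part 2's per-packet bounds — left
  to the sequel.
So at genuine sharp data over odd unramified bad primes the typed Corollary 3.12 is DECIDED, up to that constant, by the
sign of `Qside − Θside` — a bookkeeping of bad masses and `q`-depths (for single-bad-place sharp data: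
`Qside − Θside = Σ_p log p·D_p·β_p·(PN_i((i+1)²β_p^{i+1}) − 1)`), in BOTH directions, independently of the disputed
inference. HONEST SCOPE: (Ind2) as typed at the real setting (`Real.ismDH`); sharp (Ind3) reading; trivial archimedean
container; free ideles (realising ideles of an initial Θ-datum exist iff `2l ∣ ord_v(q_v)`, plan C-R16); the positive
instances are «inflation-dominated» and say nothing about print's intended content; nothing here asserts or denies
[IUTchIII] Cor. 3.12 for initial Θ-data. typed ≠ proved; instantiated ≠ endorsed. [claim: Mochizuki2012, status: disputed]
[cite: DupuyHilado2025, §3.6, §3.9, §4.7, §4.10] [cite: ScholzeStix2018, §2.2 pp. 9–10]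
-/

noncomputable section

open Set Function NumberField IsDedekindDomain
open scoped Pointwise

namespace Summit.ABC

namespace IUTFork

namespace Thm311

namespace Real

open Cor312 Cor312.Setting Cor312Vol Literature.IUT.LogThetaLattice Literature.IUT.LogVolume

variable {F : Type} [Field F] [NumberField F] (X : PilotData F) {logv : PadicLogs F} (hlog : LogvAnalytic logv)
  (M : Type) [Field M] [NumberField M]
  (archPk : ∀ (j : (thetaIndex X).Label) (vQ : (thetaIndex X).VQ), Set ((logShellsDH X logv).Packet j vQ))
  (archSub : ∀ (j : (thetaIndex X).Label) (v : (thetaIndex X).V),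
    Set ((logShellsDH X logv).Packet j ((thetaIndex X).over v)))
  (Ψ : ℤ → ∀ v : (thetaIndex X).V, v ∈ (thetaIndex X).Vbad → Set ((logShellsDH X logv).StarPacket v))
  (act : ℤ → ∀ v : (thetaIndex X).V, v ∈ (thetaIndex X).Vbad →
    (logShellsDH X logv).StarPacket v → Module.End ℚ ((logShellsDH X logv).StarPacket v))
  (Mmod : ℤ → ∀ j : (thetaIndex X).LabelStar, Set ((logShellsDH X logv).GlobalPacket j.1))
  (region : ℤ → ∀ j : (thetaIndex X).LabelStar, FinDivisor M → ∀ vQ : (thetaIndex X).VQ,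
    Set ((logShellsDH X logv).Packet j.1 vQ))
  (n : ℤ) {HT : Type} {LogLink : HT → HT → Type} {IsFull : ∀ {s t : HT}, LogLink s t → Prop}
  (lat : LGPGaussianLogThetaLattice LogLink IsFull)
  {Frd : Type} {IsoF : Frd → Frd → Type} {Ob : Frd → Type} {realify : Frd → Frd} {Strip : Type}
  {IsoS : Strip → Strip → Type} {Mv : ∀ v : (thetaIndex X).V, v ∈ (thetaIndex X).Vbad → Type}
  [∀ v h, Monoid (Mv v h)]
  (sig : GlobalLGPFrobenioidSignature (thetaIndex X).lstar (thetaIndex X).V (· ∈ (thetaIndex X).Vbad)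
    Frd IsoF Ob realify Strip IsoS Mv)
  (split : SplittingMonoids Mv) {ObΔ : Type} {N : ∀ v : (thetaIndex X).V, v ∈ (thetaIndex X).Vbad → Type}
  [∀ v h, Monoid (N v h)] (qData : QPilotData ObΔ N)
  (t : ∀ (pp : Nat.Primes) (_ : Fin X.lstar) (x : (thetaIndex X).Fibre (.inr pp)),
    haveI : Fact (pp : ℕ).Prime := ⟨pp.2⟩; kOf X pp.1 x)
  (tq : ∀ (pp : Nat.Primes) (x : (thetaIndex X).Fibre (.inr pp)), haveI : Fact (pp : ℕ).Prime := ⟨pp.2⟩; kOf X pp.1 x)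

/-! ## §1. The Θ-side from below, EXACTLY at the odd unramified bad primes -/

/-- **The local Θ-term in numbers at an odd packet `p ∤ disc(F)`** (`untopD` form of abc-iut-c312-5's
`thetaLocal_settingPrVolSharp_eq_of_zpow`). [cite: DupuyHilado2025, §3.6, §3.9, §4.7] -/
theorem thetaLocal_untopD_settingPrVolSharp_eq_of_zpow (ht0 : ∀ pp i x, t pp i x ≠ 0) (htq0 : ∀ pp x, tq pp x ≠ 0)
    (htq1 : ∀ (pp : Nat.Primes) (x : (thetaIndex X).Fibre (.inr pp)),
      haveI : Fact (pp : ℕ).Prime := ⟨pp.2⟩; placeOf X pp.1 x ∉ X.S → ‖tq pp x‖ = 1)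
    (i : Fin (thetaIndex X).lstar) (pp : Nat.Primes) (hp2 : 2 < (pp : ℕ))
    (hdisc : ¬ ((pp : ℕ) : ℤ) ∣ NumberField.discr F) (m : (thetaIndex X).Fibre (.inr pp) → ℤ)
    (hm : haveI : Fact (pp : ℕ).Prime := ⟨pp.2⟩; ∀ x, ‖t pp i x‖ = ‖((pp : ℕ) : ℚ_[pp]) ^ m x‖) :
    haveI : Fact (pp : ℕ).Prime := ⟨pp.2⟩
    ((settingPrVolSharp X hlog M archPk archSub Ψ act Mmod region n lat sig split qData tq t htq0 htq1).thetaLocal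
        (Setting.labelSucc i) (.inr pp)).untopD 0 =
      ∑ e : (presAt X hlog pp).toLocalPieces.E (Setting.labelSucc i),
        weightPr X pp.1 (Setting.labelSucc i) e *
          (-(Finset.univ.inf' Finset.univ_nonempty (fun a => m (e a)) * Real.log (pp : ℕ))) := by
  haveI : Fact (pp : ℕ).Prime := ⟨pp.2⟩
  rw [thetaLocal_settingPrVolSharp_eq_of_zpow X hlog M archPk archSub Ψ act Mmod region n t tq lat sig split qData ht0
    htq0 htq1 i pp hp2 hdisc m hm]
  rfl

/-- **Box ≤ hull in numbers at EVERY prime** for the sharp setting with free ideles: the local Θ-term dominates the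
(Ind3)-region's own volume `Σ_{v⃗} Pr(v⃗)·log ‖t_{Θ,i+1,v⃗(last)}‖` (abc-iut-c312-6 monotonicity + abc-iut-c312-7
`logvol_thetaRegion3_sharp_Pr_inr`). [cite: DupuyHilado2025, §3.9] -/
theorem sum_weightPr_log_le_thetaLocal_untopD_settingPrVolSharp (ht0 : ∀ pp i x, t pp i x ≠ 0)
    (ht1 : ∀ (pp : Nat.Primes) (i : Fin X.lstar) (x : (thetaIndex X).Fibre (.inr pp)),
      haveI : Fact (pp : ℕ).Prime := ⟨pp.2⟩; placeOf X pp.1 x ∉ X.S → ‖t pp i x‖ = 1)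
    (htq0 : ∀ pp x, tq pp x ≠ 0)
    (htq1 : ∀ (pp : Nat.Primes) (x : (thetaIndex X).Fibre (.inr pp)),
      haveI : Fact (pp : ℕ).Prime := ⟨pp.2⟩; placeOf X pp.1 x ∉ X.S → ‖tq pp x‖ = 1)
    (i : Fin (thetaIndex X).lstar) (pp : Nat.Primes) :
    haveI : Fact (pp : ℕ).Prime := ⟨pp.2⟩
    ∑ e : (presAt X hlog pp).toLocalPieces.E (Setting.labelSucc i),
        weightPr X pp.1 (Setting.labelSucc i) e * Real.log ‖t pp i (e (Fin.last _))‖ ≤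
      ((settingPrVolSharp X hlog M archPk archSub Ψ act Mmod region n lat sig split qData tq t htq0 htq1).thetaLocal
        (Setting.labelSucc i) (.inr pp)).untopD 0 := by
  haveI : Fact (pp : ℕ).Prime := ⟨pp.2⟩
  have hfin := thetaFinite_settingPrVolSharp X hlog M archPk archSub Ψ act Mmod region n lat sig split qData t tq ht0 ht1
    htq0 htq1
  have hadm := thetaRegionsAdm_settingPrVolSharp X hlog M archPk archSub Ψ act Mmod region n lat sig split qData t tq ht0
    htq0 htq1
  have hmono := logvolMono_settingPrVol X hlog M archPk archSub Ψ act Mmod region n lat sig split qData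
    (fun _ _ => thetaBoxDH X hlog (sharpBoxDH X hlog t)) (fun _ => qCentreDH X hlog tq)
    (qCentreDH_ne_zero X hlog tq htq0)
    (finite_support_logvol_qRegion_Pr X hlog M archPk archSub Ψ act Mmod region n tq htq0 htq1)
  have h := logvol_thetaRegion_le_thetaLocal_of_mono hmono hfin hadm 0 i (.inr pp)
  have hval := logvol_thetaRegion3_sharp_Pr_inr X hlog M archPk archSub Ψ act Mmod region n lat sig split qData
    (fun _ => qCentreDH X hlog tq) (qCentreDH_ne_zero X hlog tq htq0)
    (finite_support_logvol_qRegion_Pr X hlog M archPk archSub Ψ act Mmod region n tq htq0 htq1) t ht0 i pp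
  rw [thetaRegion3_thetaBoxDH_Pr] at hval
  have h' : ((situationPrVol X hlog M archPk archSub Ψ act Mmod region).D n).logvol (Setting.labelSucc i) (.inr pp)
      (factorMapDH X hlog (Setting.labelSucc i) (.inr pp) ⁻¹'
        thetaBoxDH X hlog (sharpBoxDH X hlog t) (Setting.labelSucc i) (.inr pp)) ≤
      ((settingPrVolSharp X hlog M archPk archSub Ψ act Mmod region n lat sig split qData tq t htq0 htq1).thetaLocal
        (Setting.labelSucc i) (.inr pp)).untopD 0 := h
  exact hval.symm.le.trans h'

/-- **The Θ-side from below, globally**: for pilot ideles (non-zero, units off `S`) with every prime under `S` in a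
finite set `U` of ODD primes UNRAMIFIED in `F`, and Θ-exponents `‖t_{Θ,i+1,v}‖ = ‖p^{m_{i,p}(v)}‖` over `p ∈ U`:
`−|log(Θ)| ≥ PN_i Σ_{p∈U} Σ_{v⃗} Pr(v⃗)·(−min_a m_{i,p}(v⃗ a)·log p)` (EXACT at `U`, abc-iut-c312-5; `≥ 0` at every other
packet: box ≤ hull and the box is the unit box there). [cite: DupuyHilado2025, §3.6, §3.9, §4.7] -/
theorem negLogTheta_settingPrVolSharp_ge_exact (ht0 : ∀ pp i x, t pp i x ≠ 0)
    (ht1 : ∀ (pp : Nat.Primes) (i : Fin X.lstar) (x : (thetaIndex X).Fibre (.inr pp)),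
      haveI : Fact (pp : ℕ).Prime := ⟨pp.2⟩; placeOf X pp.1 x ∉ X.S → ‖t pp i x‖ = 1)
    (htq0 : ∀ pp x, tq pp x ≠ 0)
    (htq1 : ∀ (pp : Nat.Primes) (x : (thetaIndex X).Fibre (.inr pp)),
      haveI : Fact (pp : ℕ).Prime := ⟨pp.2⟩; placeOf X pp.1 x ∉ X.S → ‖tq pp x‖ = 1)
    (U : Finset Nat.Primes)
    (hU : ∀ (pp : Nat.Primes) (x : (thetaIndex X).Fibre (.inr pp)),
      haveI : Fact (pp : ℕ).Prime := ⟨pp.2⟩; placeOf X pp.1 x ∈ X.S → pp ∈ U)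
    (hU2 : ∀ pp ∈ U, 2 < (pp : ℕ)) (hUd : ∀ pp ∈ U, ¬ ((pp : ℕ) : ℤ) ∣ NumberField.discr F)
    (m : ∀ pp : Nat.Primes, Fin (thetaIndex X).lstar → (thetaIndex X).Fibre (.inr pp) → ℤ)
    (hm : ∀ (pp : Nat.Primes), pp ∈ U → ∀ (i : Fin (thetaIndex X).lstar) (x : (thetaIndex X).Fibre (.inr pp)),
      haveI : Fact (pp : ℕ).Prime := ⟨pp.2⟩; ‖t pp i x‖ = ‖((pp : ℕ) : ℚ_[pp]) ^ m pp i x‖) :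
    ((processionNormalized (fun i : Fin (thetaIndex X).lstar => ∑ pp ∈ U,
        (haveI : Fact (pp : ℕ).Prime := ⟨pp.2⟩;
          ∑ e : (presAt X hlog pp).toLocalPieces.E (Setting.labelSucc i),
            weightPr X pp.1 (Setting.labelSucc i) e *
              (-(Finset.univ.inf' Finset.univ_nonempty (fun a => m pp i (e a)) * Real.log (pp : ℕ))))) : ℝ) : WithTop ℝ) ≤
      (settingPrVolSharp X hlog M archPk archSub Ψ act Mmod region n lat sig split qData tq t htq0 htq1).negLogTheta := by
  set P := settingPrVolSharp X hlog M archPk archSub Ψ act Mmod region n lat sig split qData tq t htq0 htq1 with hP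
  have hfinΘ : P.ThetaFinite :=
    thetaFinite_settingPrVolSharp X hlog M archPk archSub Ψ act Mmod region n lat sig split qData t tq ht0 ht1 htq0 htq1
  unfold Setting.negLogTheta
  rw [if_pos hfinΘ, WithTop.coe_le_coe]
  refine processionNormalized_mono fun i => ?_
  -- lower function: the exact term on `U`, `0` elsewhere
  let b : (thetaIndex X).VQ → ℝ := fun vQ =>
    match vQ with
    | .inl _ => 0
    | .inr pp => if pp ∈ U then
        (haveI : Fact (pp : ℕ).Prime := ⟨pp.2⟩;
          ∑ e : (presAt X hlog pp).toLocalPieces.E (Setting.labelSucc i),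
            weightPr X pp.1 (Setting.labelSucc i) e *
              (-(Finset.univ.inf' Finset.univ_nonempty (fun a => m pp i (e a)) * Real.log (pp : ℕ))))
      else 0
  have hb_supp : (Function.support b) ⊆
      ((U.map ⟨(Sum.inr : Nat.Primes → (thetaIndex X).VQ), fun _ _ h => Sum.inr_injective h⟩ :
        Finset (thetaIndex X).VQ) : Set (thetaIndex X).VQ) := by
    intro vQ hvQ
    rw [Function.mem_support] at hvQ
    rcases vQ with u | pp
    · exact absurd rfl hvQ
    · rw [Finset.coe_map, Set.mem_image]
      by_cases hpp : pp ∈ U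
      · exact ⟨pp, Finset.mem_coe.mpr hpp, rfl⟩
      · exact absurd (by show b (.inr pp) = 0; exact if_neg hpp) hvQ
  have hb_fin : (Function.support b).Finite := (Finset.finite_toSet _).subset hb_supp
  have hsum : ∑ᶠ vQ, b vQ = ∑ pp ∈ U,
      (haveI : Fact (pp : ℕ).Prime := ⟨pp.2⟩;
        ∑ e : (presAt X hlog pp).toLocalPieces.E (Setting.labelSucc i),
          weightPr X pp.1 (Setting.labelSucc i) e *
            (-(Finset.univ.inf' Finset.univ_nonempty (fun a => m pp i (e a)) * Real.log (pp : ℕ)))) := by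
    rw [finsum_eq_sum_of_support_subset b hb_supp, Finset.sum_map]
    exact Finset.sum_congr rfl fun pp hpp => if_pos hpp
  rw [← hsum]
  refine finsum_le_finsum' hb_fin (hfinΘ.2 i) fun vQ => ?_
  rcases vQ with u | pp
  · show (0 : ℝ) ≤ (P.thetaLocal (labelSucc i) (.inl u)).untopD 0
    exact (thetaLocal_settingPrVol_untopD_inl X hlog M archPk archSub Ψ act Mmod region n lat sig split qData _ _ _ _ u i
      (bridgeHyps_settingPrVolSharp_of_ideles X hlog M archPk archSub Ψ act Mmod region n lat sig split qData t tq ht0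
        ht1 htq0 htq1)).ge
  · haveI : Fact (pp : ℕ).Prime := ⟨pp.2⟩
    by_cases hpp : pp ∈ U
    · show b (.inr pp) ≤ (P.thetaLocal (labelSucc i) (.inr pp)).untopD 0
      rw [show b (.inr pp) = _ from if_pos hpp,
        thetaLocal_untopD_settingPrVolSharp_eq_of_zpow X hlog M archPk archSub Ψ act Mmod region n lat sig split qData t
          tq ht0 htq0 htq1 i pp (hU2 pp hpp) (hUd pp hpp) (m pp i) (hm pp hpp i)]
    · show b (.inr pp) ≤ (P.thetaLocal (labelSucc i) (.inr pp)).untopD 0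
      rw [show b (.inr pp) = 0 from if_neg hpp]
      refine le_trans (le_of_eq ?_) (sum_weightPr_log_le_thetaLocal_untopD_settingPrVolSharp X hlog M archPk archSub
        Ψ act Mmod region n lat sig split qData t tq ht0 ht1 htq0 htq1 i pp)
      refine (Finset.sum_eq_zero fun e _ => ?_).symm
      rw [ht1 pp i _ (fun hS => hpp (hU pp _ hS)), Real.log_one, mul_zero]

/-! ## §2. The `q`-side EXACTLY -/

/-- **`−|log(q)|` in numbers** for `q`-ideles with every place of `S` above a prime of `U` and `q`-exponents
`‖t_{q,v}‖ = ‖p^{m_{q,p}(v)}‖` over `p ∈ U`: `−|log(q)| = PN_i Σ_{p∈U} Σ_{v⃗} Pr(v⃗)·(−m_{q,p}(v⃗(last))·log p)`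
(abc-iut-c312-7 `logvol_qRegion_Pr_inr`, packet by packet). [cite: DupuyHilado2025, §3.9, Thm. 3.10.1] -/
theorem negLogQ_settingPrVolSharp_eq_exact (htq0 : ∀ pp x, tq pp x ≠ 0)
    (htq1 : ∀ (pp : Nat.Primes) (x : (thetaIndex X).Fibre (.inr pp)),
      haveI : Fact (pp : ℕ).Prime := ⟨pp.2⟩; placeOf X pp.1 x ∉ X.S → ‖tq pp x‖ = 1)
    (U : Finset Nat.Primes)
    (hU : ∀ (pp : Nat.Primes) (x : (thetaIndex X).Fibre (.inr pp)),
      haveI : Fact (pp : ℕ).Prime := ⟨pp.2⟩; placeOf X pp.1 x ∈ X.S → pp ∈ U)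
    (mq : ∀ pp : Nat.Primes, (thetaIndex X).Fibre (.inr pp) → ℤ)
    (hmq : ∀ (pp : Nat.Primes), pp ∈ U → ∀ (x : (thetaIndex X).Fibre (.inr pp)),
      haveI : Fact (pp : ℕ).Prime := ⟨pp.2⟩; ‖tq pp x‖ = ‖((pp : ℕ) : ℚ_[pp]) ^ mq pp x‖) :
    (settingPrVolSharp X hlog M archPk archSub Ψ act Mmod region n lat sig split qData tq t htq0 htq1).negLogQ =
      processionNormalized (fun i : Fin (thetaIndex X).lstar => ∑ pp ∈ U,
        (haveI : Fact (pp : ℕ).Prime := ⟨pp.2⟩;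
          ∑ e : (presAt X hlog pp).toLocalPieces.E (Setting.labelSucc i),
            weightPr X pp.1 (Setting.labelSucc i) e * (-(mq pp (e (Fin.last _))) * Real.log (pp : ℕ)))) := by
  set P := settingPrVolSharp X hlog M archPk archSub Ψ act Mmod region n lat sig split qData tq t htq0 htq1 with hP
  unfold Setting.negLogQ
  congr 1
  funext i
  have hloc : ∀ pp : Nat.Primes, haveI : Fact (pp : ℕ).Prime := ⟨pp.2⟩
      P.qLocal (labelSucc i) (.inr pp) =
        ∑ e : (presAtPr X hlog pp).toLocalPieces.E (labelSucc i),
          weightPr X pp.1 (labelSucc i) e * Real.log ‖tq pp (e (Fin.last _))‖ := fun pp =>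
    logvol_qRegion_Pr_inr X hlog M archPk archSub Ψ act Mmod region n tq htq0 (labelSucc i) pp
  let g : (thetaIndex X).VQ → ℝ := fun vQ =>
    match vQ with
    | .inl _ => 0
    | .inr pp => if pp ∈ U then
        (haveI : Fact (pp : ℕ).Prime := ⟨pp.2⟩;
          ∑ e : (presAt X hlog pp).toLocalPieces.E (Setting.labelSucc i),
            weightPr X pp.1 (Setting.labelSucc i) e * (-(mq pp (e (Fin.last _))) * Real.log (pp : ℕ)))
      else 0
  have hg_supp : (Function.support g) ⊆
      ((U.map ⟨(Sum.inr : Nat.Primes → (thetaIndex X).VQ), fun _ _ h => Sum.inr_injective h⟩ :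
        Finset (thetaIndex X).VQ) : Set (thetaIndex X).VQ) := by
    intro vQ hvQ
    rw [Function.mem_support] at hvQ
    rcases vQ with u | pp
    · exact absurd rfl hvQ
    · rw [Finset.coe_map, Set.mem_image]
      by_cases hpp : pp ∈ U
      · exact ⟨pp, Finset.mem_coe.mpr hpp, rfl⟩
      · exact absurd (by show g (.inr pp) = 0; exact if_neg hpp) hvQ
  have hsum : ∑ᶠ vQ, g vQ = ∑ pp ∈ U,
      (haveI : Fact (pp : ℕ).Prime := ⟨pp.2⟩;
        ∑ e : (presAt X hlog pp).toLocalPieces.E (Setting.labelSucc i),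
          weightPr X pp.1 (Setting.labelSucc i) e * (-(mq pp (e (Fin.last _))) * Real.log (pp : ℕ))) := by
    rw [finsum_eq_sum_of_support_subset g hg_supp, Finset.sum_map]
    exact Finset.sum_congr rfl fun pp hpp => if_pos hpp
  rw [← hsum]
  refine finsum_congr fun vQ => ?_
  rcases vQ with u | pp
  · exact logvol_situationPrVol_inl X hlog M archPk archSub Ψ act Mmod region n u _ _
  · haveI : Fact (pp : ℕ).Prime := ⟨pp.2⟩
    show P.qLocal (labelSucc i) (.inr pp) = g (.inr pp)
    rw [hloc pp]
    by_cases hpp : pp ∈ U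
    · rw [show g (.inr pp) = _ from if_pos hpp]
      refine Finset.sum_congr rfl fun e _ => ?_
      rw [hmq pp hpp, norm_zpow, Padic.norm_p, Real.log_zpow, Real.log_inv]
      ring
    · rw [show g (.inr pp) = 0 from if_neg hpp]
      refine Finset.sum_eq_zero fun e _ => ?_
      rw [htq1 pp _ (fun hS => hpp (hU pp _ hS)), Real.log_one, mul_zero]

/-! ## §3. The POSITIVE regime: `Qside ≤ Θside ⟹ Statement` -/

/-- **A POSITIVE instance of the typed [IUTchIII] Cor. 3.12 AT GENUINE DATA (inflation-dominated regime).** For pilot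
ideles (non-zero, units off `S`) whose bad places all lie over a finite set `U` of ODD primes UNRAMIFIED in `F`, with
Θ-exponents `m_{i,p}` and `q`-exponents `m_{q,p}` over `U`: if the slot-symmetrised Θ-exponent mass does not exceed the
`q`-exponent mass,
`PN_i Σ_{p∈U} Σ_{v⃗} Pr(v⃗)·(−m_{q,p}(v⃗(last))·log p) ≤ PN_i Σ_{p∈U} Σ_{v⃗} Pr(v⃗)·(−min_a m_{i,p}(v⃗ a)·log p)`,
then the typed Statement `−|log(Θ)| ∈ ℝ ∧ −|log(q)| ≤ −|log(Θ)|` HOLDS at `Real.settingPrVolSharp` for these ideles.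
E.g. sharp ideles (`m_{i,p} = (i+1)²·m_{q,p}`) supported at one bad place of bad mass `β_p` per prime with
`PN_i((i+1)²β_p^{i+1}) ≤ 1` (split primes). The inequality holds BY THE (Ind1)-INFLATION at the mixed packets (the typed
hull raises the Θ-volume at every packet `v⃗` with a good slot to the unit box) — NOT by the disputed (xi-e)/(xi-f)
inference; no side taken. [claim: Mochizuki2012, status: disputed] [cite: DupuyHilado2025, §3.6, §4.7] -/
theorem statement_settingPrVolSharp_of_qside_le_thetaside (ht0 : ∀ pp i x, t pp i x ≠ 0)
    (ht1 : ∀ (pp : Nat.Primes) (i : Fin X.lstar) (x : (thetaIndex X).Fibre (.inr pp)),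
      haveI : Fact (pp : ℕ).Prime := ⟨pp.2⟩; placeOf X pp.1 x ∉ X.S → ‖t pp i x‖ = 1)
    (htq0 : ∀ pp x, tq pp x ≠ 0)
    (htq1 : ∀ (pp : Nat.Primes) (x : (thetaIndex X).Fibre (.inr pp)),
      haveI : Fact (pp : ℕ).Prime := ⟨pp.2⟩; placeOf X pp.1 x ∉ X.S → ‖tq pp x‖ = 1)
    (U : Finset Nat.Primes)
    (hU : ∀ (pp : Nat.Primes) (x : (thetaIndex X).Fibre (.inr pp)),
      haveI : Fact (pp : ℕ).Prime := ⟨pp.2⟩; placeOf X pp.1 x ∈ X.S → pp ∈ U)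
    (hU2 : ∀ pp ∈ U, 2 < (pp : ℕ)) (hUd : ∀ pp ∈ U, ¬ ((pp : ℕ) : ℤ) ∣ NumberField.discr F)
    (m : ∀ pp : Nat.Primes, Fin (thetaIndex X).lstar → (thetaIndex X).Fibre (.inr pp) → ℤ)
    (hm : ∀ (pp : Nat.Primes), pp ∈ U → ∀ (i : Fin (thetaIndex X).lstar) (x : (thetaIndex X).Fibre (.inr pp)),
      haveI : Fact (pp : ℕ).Prime := ⟨pp.2⟩; ‖t pp i x‖ = ‖((pp : ℕ) : ℚ_[pp]) ^ m pp i x‖)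
    (mq : ∀ pp : Nat.Primes, (thetaIndex X).Fibre (.inr pp) → ℤ)
    (hmq : ∀ (pp : Nat.Primes), pp ∈ U → ∀ (x : (thetaIndex X).Fibre (.inr pp)),
      haveI : Fact (pp : ℕ).Prime := ⟨pp.2⟩; ‖tq pp x‖ = ‖((pp : ℕ) : ℚ_[pp]) ^ mq pp x‖)
    (hreg : processionNormalized (fun i : Fin (thetaIndex X).lstar => ∑ pp ∈ U,
          (haveI : Fact (pp : ℕ).Prime := ⟨pp.2⟩;
            ∑ e : (presAt X hlog pp).toLocalPieces.E (Setting.labelSucc i),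
              weightPr X pp.1 (Setting.labelSucc i) e * (-(mq pp (e (Fin.last _))) * Real.log (pp : ℕ)))) ≤
        processionNormalized (fun i : Fin (thetaIndex X).lstar => ∑ pp ∈ U,
          (haveI : Fact (pp : ℕ).Prime := ⟨pp.2⟩;
            ∑ e : (presAt X hlog pp).toLocalPieces.E (Setting.labelSucc i),
              weightPr X pp.1 (Setting.labelSucc i) e *
                (-(Finset.univ.inf' Finset.univ_nonempty (fun a => m pp i (e a)) * Real.log (pp : ℕ)))))) :
    (settingPrVolSharp X hlog M archPk archSub Ψ act Mmod region n lat sig split qData tq t htq0 htq1).Statement := by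
  set P := settingPrVolSharp X hlog M archPk archSub Ψ act Mmod region n lat sig split qData tq t htq0 htq1 with hP
  have hfinΘ : P.ThetaFinite :=
    thetaFinite_settingPrVolSharp X hlog M archPk archSub Ψ act Mmod region n lat sig split qData t tq ht0 ht1 htq0 htq1
  have hne : P.negLogTheta ≠ ⊤ := by
    unfold Setting.negLogTheta; rw [if_pos hfinΘ]; exact WithTop.coe_ne_top
  refine ⟨hne, ?_⟩
  rw [negLogQ_settingPrVolSharp_eq_exact X hlog M archPk archSub Ψ act Mmod region n lat sig split qData t tq htq0 htq1 U
    hU mq hmq]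
  exact (WithTop.coe_le_coe.mpr hreg).trans
    (negLogTheta_settingPrVolSharp_ge_exact X hlog M archPk archSub Ψ act Mmod region n lat sig split qData t tq ht0 ht1
      htq0 htq1 U hU hU2 hUd m hm)

end Real

end Thm311

end IUTFork

end Summit.ABC

end
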